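import Summits.BirchSwinnertonDyer.BirchSwinnertonDyer.Theorems.MordellShaFreeCutThreeAdicBDPTriple
import Summits.BirchSwinnertonDyer.Rank1Residual.X11b.BDPValueRigidity

set_option linter.dupNamespace false
set_option autoImplicit false

/-! # Route `MordellShaFreeCut` (rung S2b) — what the ∀-FRAME quantifier of the registered (LB-bdp)
`ThreeAdicBDPValueAtOne` costs: a CHARACTER SUPPLY, by the tree's value-at-𝟙 rigidity theorem
(LEMMA R of the cell's MEMO-transfer-13 §5.3 is `X11b.constantCoeff_eq_of_isBDPLFunction_of_supply`)

Cell `bsd-cn100`, prover seat `bsd-cn100-s2b-c3` (g7). Supports, does not close,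
stmt-BirchSwinnertonDyer-19160; serves the registered BDP line `heegner-field-bdp-triple` v6bp on
stmt-BirchSwinnertonDyer-19159, stub `stub_threeAdicBDPValueAtOne : ThreeAdicBDPValueAtOne` — the BDP
formula at the trivial character for EVERY admissible `(Ω_K, Ω_p, 𝓛)` of the frame
`IsBDPLFunction ι' v κ γ f Ω_K Ω_p 𝓛`, at every embedding datum `ι'` inducing `v`.

The written mathematics (Castella 2018 Thm. 3.2 at `p ∤ N`; the cell's transplant MEMO-transfer-13 Thm. 13.2
at the additive prime) computes the value at `𝟙` of ONE constructed frame; MEMO-transfer-13 §5.3 then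
transfers it to every admissible tuple by a RIGIDITY LEMMA ("Lemma R"), recorded there as research-note
grade and as «Lean Lemma R — NOT done (needs a Strassmann lemma)». THIS FILE RECORDS THAT LEMMA R IS A
TREE THEOREM, at every prime and without Strassmann: cell `b2b-bsdres`'s S27 'V1RIG'
`Summit.BirchSwinnertonDyer.Rank1Residual.X11b.constantCoeff_eq_of_isBDPLFunction_of_supply`
(`X11b/BDPValueRigidity.lean`: two frames of the same `(ι', 𝔭, κ, γ, f)` have THE SAME constant term
`[T⁰]𝓛' = [T⁰]𝓛`, given a character supply accumulating at `𝟙`; proof = continuity of evaluation at `𝟙`,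
`a_k → ρ`, `a_k² → ρ`, `ρ² = ρ`, and the order lemma excluding `ρ = 0`), and draws the consequence for
S2b in the pattern of `X11b.Three.bdpValueAt₃_of_frameValue_of_supply`:

* `threeAdicBDPValueAtOne_of_frameValue_of_supply` — **(LB-bdp) ∀-frame `ThreeAdicBDPValueAtOne` ⟸
  (i) a CHARACTER SUPPLY at every `(K, ι', κ, γ)` in scope (HYPOTHESIS `hsup`, X11b's binder verbatim at
  `p = 3`: `m > 0`, `x₀ ∈ ℂ₃` with `x₀^{3^k} → 1`, interpolation data of infinity types `m·3^k`, `2m·3^k`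
  with avatar values `x₀^{3^k}`, `x₀^{2·3^k}` — in nature the powers of one unramified anticyclotomic
  character of infinity type `(1, −1)`; the tree does not construct Hecke characters of prescribed type)
  and (ii) the ∃∧ statement AT EVERY `ι'` inducing `v`: ONE admissible `(Ω_K, Ω_p, 𝓛)` WITH its value at
  `𝟙` (HYPOTHESIS `hEV`, inline).** So the ∀-frame quantifier of the registered stub costs exactly a
  character supply beyond the one-frame statement at each `ι'`; frames at different `ι'` are not compared.

Sibling: `MordellShaFreeCutThreeAdicBDPExistsValue.lean` (the BDP road's plumbing and censuses never use more
than ONE frame with its value — the `∃ ι'` form `ThreeAdicBDPElementExistsWithValue`).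

HONEST FRAMING: a CONDITIONAL reduction over an existing theorem of another cell; nothing here proves
(LB-exist), (LB-wan), (LB-bdp), crux A, crux B, the leaf, Sylvester's conjecture or any case of BSD;
the character supply is a hypothesis, not asserted. PARTITION: none — RANK axis.

[cite: Castella2018, Thm. 3.1–3.2 (arXiv:1704.06608 pp. 8–9) (interpolation shape; the rigidity statement is elementary p-adic analysis on R₀⟦T⟧)]
[cite: CastellaHsieh2018, §3.3, Def. 3.5 and Prop. 3.6 (shape)]
[cite: BertoliniDarmonPrasanna2013, Thm. 5.13 (shape of the value at the trivial character)] -/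

noncomputable section

open scoped Classical Topology

namespace Summit.BirchSwinnertonDyer.BirchSwinnertonDyer.Theorems.MordellShaFreeCutThreeAdicBDPValueRigidity

open Filter PowerSeries WeierstrassCurve NumberField IsDedekindDomain Field
  Literature.NumberTheory.EllipticCurves Literature.NumberTheory.EllipticCurves.ModularForms
  Literature.NumberTheory.QuadraticFields Literature.NumberTheory.EllipticCurves.Castella2018
open Literature.NumberTheory.GaloisRepresentations Literature.NumberTheory.GaloisCohomology
open Summit.BirchSwinnertonDyer.BirchSwinnertonDyer.Theorems.MordellShaFreeCutThreeAdicBDPTriple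
  (ThreeAdicBDPValueAtOne)
open Summit.BirchSwinnertonDyer.Rank1Residual.X11b (constantCoeff_eq_of_isBDPLFunction_of_supply)

/-- **(LB-bdp) ∀-frame `ThreeAdicBDPValueAtOne` from the one-frame-with-value statement at every `ι'` and a
character supply** — LEMMA R of MEMO-transfer-13 §5.3 entering as the THEOREM
`X11b.constantCoeff_eq_of_isBDPLFunction_of_supply` (any `p`; here `p = 3`): given the registered stub's
data `(W, ι', K, N, Dt, H, w, e, v, κ, γ, P)` and an arbitrary admissible `(Ω_K', Ω_p', 𝓛')`, take the
reference frame `(Ω_K, Ω_p, 𝓛)` WITH `𝓛(𝟙) = u·c⁻²·(1 − a₃3⁻¹ + [3 ∤ N]3⁻¹)²·(log_ω P)²` supplied by `hEV`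
at the same `ι'`, and the supply `hsup K ι' κ γ`; rigidity gives `[T⁰]𝓛' = [T⁰]𝓛`, so `𝓛'(𝟙)` is the same
`u·(…)`. The supply (`hsup`) and the one-frame statement (`hEV`) are HYPOTHESES; nothing is asserted at the
additive prime `3`. [cite: Castella2018, Thm. 3.1–3.2 (arXiv:1704.06608 pp. 8–9) (shape only; nothing asserted)] -/
theorem threeAdicBDPValueAtOne_of_frameValue_of_supply
    (hsup : ∀ (K : Type) [Field K] [NumberField K] (ι : PadicAlgCl 3 ≃+* ℂ) (κ : ZpExtension K 3)
      (γ : Field.absoluteGaloisGroup K), IsImaginaryQuadratic K → κ.IsAnticyclotomic →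
      κ.IsTopGenerator γ →
      ∃ (m : ℕ) (x₀ : ℂ_[3]) (φ φ' : ℕ → HeckeCharacter K)
        (r r' : ℕ → FramedGaloisRep K (PadicAlgCl 3) 1),
        0 < m ∧ (∀ k, x₀ ^ 3 ^ k ≠ 1) ∧ Tendsto (fun k ↦ x₀ ^ 3 ^ k) atTop (𝓝 1) ∧
        (∀ k (v : HeightOneSpectrum (𝓞 K)), (φ k).IsUnramifiedAt v) ∧
        (∀ k, (φ k).HasInfinityType (fun _ ↦ ((m * 3 ^ k : ℕ) : ℤ))
          (fun _ ↦ -((m * 3 ^ k : ℕ) : ℤ))) ∧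
        (∀ k, IsPAdicAvatarOf ι (φ k) (r k)) ∧ (∀ k, FactorsThroughZp κ (r k)) ∧
        (∀ k, avatarValueAt (r k) γ = x₀ ^ 3 ^ k) ∧
        (∀ k (v : HeightOneSpectrum (𝓞 K)), (φ' k).IsUnramifiedAt v) ∧
        (∀ k, (φ' k).HasInfinityType (fun _ ↦ ((2 * m * 3 ^ k : ℕ) : ℤ))
          (fun _ ↦ -((2 * m * 3 ^ k : ℕ) : ℤ))) ∧
        (∀ k, IsPAdicAvatarOf ι (φ' k) (r' k)) ∧ (∀ k, FactorsThroughZp κ (r' k)) ∧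
        (∀ k, avatarValueAt (r' k) γ = x₀ ^ (2 * 3 ^ k)))
    (hEV : ∀ (W : WeierstrassCurve ℚ) [W.IsElliptic] [W.IsGloballyMinimal], W.j = 0 →
      ∀ (ι' : PadicAlgCl 3 ≃+* ℂ) (K : Type) [Field K] [NumberField K] (N : ℕ) [NeZero N]
        (Dt : ModularParametrizationData W N)
        (H : HeegnerDatum N (NumberField.discr K)) (w : InfinitePlace K) (e : K →+* ℚ_[3])
        (v : HeightOneSpectrum (𝓞 K)) (κ : ZpExtension K 3) (γ : absoluteGaloisGroup K)
        [Fact (κ.IsTopGenerator γ)] (P : (W.baseChange K).toAffine.Point),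
      W.conductorNorm ℤ = N → IsImaginaryQuadratic K →
      SatisfiesHeegnerHypothesis N K → ((Ideal.span {(3 : ℤ)}).primesOver (𝓞 K)).ncard = 2 →
      ((3 : ℕ) : 𝓞 K) ∈ v.asIdeal →
      (∀ (w' : InfinitePlace K) (k : 𝓞 K), k ∈ v.asIdeal ↔ ‖ι'.symm (w'.embedding (k : K))‖ < 1) →
      κ.IsAnticyclotomic →
      WeierstrassCurve.Affine.Point.map w.embedding.toRatAlgHom P = heegnerPointComplex Dt H →
      (∀ k : 𝓞 K, k ∈ v.asIdeal ↔ ‖e (k : K)‖ < 1) →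
      ∃ (ΩK : ℂ) (Ωp : (unrIntegers 3)ˣ) (L : UnrSeries 3),
        ΩK ≠ 0 ∧ IsBDPLFunction ι' v κ γ Dt.f ΩK ((Ωp : unrIntegers 3) : ℂ_[3]) L ∧
        ∃ u : (unrIntegers 3)ˣ, L.HasValueAt 0
          (((u : unrIntegers 3) : ℂ_[3]) *
            algebraMap ℚ_[3] ℂ_[3] (((Dt.c : ℚ_[3])⁻¹) ^ 2 *
              (1 - (W.LFunction 3 : ℚ_[3]) * (3 : ℚ_[3])⁻¹ +
                (if (3 : ℕ) ∣ N then 0 else (3 : ℚ_[3])⁻¹)) ^ 2 *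
              (padicLogOmega W 3 e P) ^ 2))) :
    ThreeAdicBDPValueAtOne := by
  intro W _ _ hj ι' K _ _ N _ Dt H w e v κ γ hγ P hN hK hHN hsplit hv3 hι' hκ hP he ΩK' Ωp' L' hΩK' hL'
  -- the reference frame at the same `ι'`, WITH its value at `𝟙`
  obtain ⟨ΩK, Ωp, L, hΩK, hL, u, hu⟩ :=
    hEV W hj ι' K N Dt H w e v κ γ P hN hK hHN hsplit hv3 hι' hκ hP he
  have hΩp : ((Ωp : unrIntegers 3) : ℂ_[3]) ≠ 0 := by
    rw [Ne, ZeroMemClass.coe_eq_zero]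
    exact Units.ne_zero Ωp
  have hΩp' : ((Ωp' : unrIntegers 3) : ℂ_[3]) ≠ 0 := by
    rw [Ne, ZeroMemClass.coe_eq_zero]
    exact Units.ne_zero Ωp'
  -- the character supply at `(K, ι', κ, γ)`
  obtain ⟨m, x₀, φ, φ', r, r', hm, hx1, hxlim, hunr, hinf, hr, hrκ, hval, hunr', hinf', hr', hrκ',
    hval'⟩ := hsup K ι' κ γ hK hκ hγ.out
  -- value-at-𝟙 rigidity across periods (X11b S27 'V1RIG', a theorem at every prime)
  have key : PowerSeries.constantCoeff L' = PowerSeries.constantCoeff L :=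
    constantCoeff_eq_of_isBDPLFunction_of_supply K N ι' v κ γ Dt.f ΩK ΩK' _ _ L L' m x₀ φ φ' r r' hm
      hx1 hxlim hunr hinf hr hrκ hval hunr' hinf' hr' hrκ' hval' hΩK hΩK' hΩp hΩp' hL hL'
  refine ⟨u, ?_⟩
  rw [UnrSeries.eq_constantCoeff_of_hasValueAt_zero hu, ← key]
  exact L'.hasValueAt_zero

end Summit.BirchSwinnertonDyer.BirchSwinnertonDyer.Theorems.MordellShaFreeCutThreeAdicBDPValueRigidity

end
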